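import Summits.QuantumFields.QCD.Theses.HeatSlicedQuarks
import Summits.QuantumFields.QCD.Theorems.HeatSlicedQuarksRobustYangMillsHandoverStubTwoConstants

/-!
# `RobustYangMillsHandover` — the Lee–Yang certificate: bounded analytic continuation in the complex
# flavour-blind quark mass transfers a heavy-anchor lattice gap down the mass axis
# (definition-free; line `lee-yang-mass-handover`, lead a2, 2026-08-16)

Crux `stmt-QuantumFields-8892` (`HeatSlicedQuarks.RobustYangMillsHandover := ContinuumQCDExists → QCD`).
This file is the line's MECHANISM as an importable theorem (its composition lives in the registered
skeleton `Cruxes/RobustYangMillsHandover/Lines/lee_yang_mass_handover.lean`; the pin that consumes it is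
`Theorems/HeatSlicedQuarksRobustYangMillsHandoverPinnedThreshold.lean`):

* `norm_le_of_ellipse_certificate` — the two-constants transfer at the target point.  Let `E(δ₀)` be the
  open Bernstein-ellipse region of complex flavour-blind mass SHIFTS `s` with foci `1, 3` and left vertex
  `−δ₀`, written as the Joukowski image `s = 2 + (z + z⁻¹)/2` of the annulus
  `1 ≤ ‖z‖ < R(δ₀) := (2+δ₀) + √((2+δ₀)²−1)`.  If `h` is holomorphic on `E(δ₀)`, bounded by `K` there and
  by `K e^{−x}` on the real anchor `[1, 3]`, then `‖h 0‖ ≤ K e^{−(1−λ*) x}` with the EXPLICIT harmonic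
  measure `λ* = log(2+√3)/log R(δ₀) ∈ (0, 1)` of the target `s = 0` (Joukowski preimage `z₀ = −(2+√3)`).
  Input: the landed `LeeYangMassHandover.stub_twoConstants` (Nevanlinna's two-constants theorem on the
  ellipse from Mathlib's Hadamard three lines, p124094).
* `hasLatticeMassGap_of_leeYangCertificate` — **the Lee–Yang handover on the lattice**: if, for a
  regularisation `reg`, an offset tuple `t`, a rate `ε > 0` and `δ₀ > 0`, every pair of gauge-invariant local
  lattice observables admits `K` such that for all large `k`, every torus `2S+1 ≥ 2L_k+1` and every
  separation `n ≤ S` the connected Euclidean-time correlator at `t` is `h 0` for some `h` holomorphic on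
  `E(δ₀)`, bounded by `K` there and by `K e^{−ε a_k n}` on the anchor shifts `s ∈ [1, 3]` (Lee–Yang: no
  complex-mass zeros of the partition function with sources near the anchor and the target; the anchor
  decay is the heavy-threshold gap at the tuples `t + s·𝟙`), then the lattice theory at `t` has the uniform
  lattice mass gap `ε (1 − λ*)` — a pair- and tuple-independent rate (Disproof §13), constants `max K 1`.
* `opensBelow_of_leeYangOpenness` — the form the pin consumes: Lee–Yang openness of `reg` (the certificate
  at every tuple of a slab below a uniformly gapped half-line of offsets) makes every uniformly gapped
  half-line of offsets open from below (`OpensBelow`, hypothesis (O) of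
  `PinnedThreshold.robustYangMillsHandover_of_pinInputs`).

Lebowitz–Penrose 1968 transplanted from the magnetic field to the quark mass; nothing here asserts a Theses
decl, and no lattice-QCD fact is assumed — the certificate is the hypothesis.
-/

namespace Summit.QuantumFields.QCD.Theorems.RobustYangMillsHandover.LeeYangCertificate

open Summit.QuantumFields.QCD.Theses.HeatSlicedQuarks
open Summit.QuantumFields.QCD.Cruxes.RobustYangMillsHandover.LeeYangMassHandover (stub_twoConstants)
open Literature.MathematicalPhysics.QuantumFieldTheory
open Filter

variable {Nf : ℕ}

/-! ## §1 The ellipse geometry -/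

/-- `1 < 2 + √3`. [folklore] -/
theorem one_lt_two_add_sqrt_three : (1 : ℝ) < 2 + Real.sqrt 3 := by
  have := Real.sqrt_nonneg 3
  linarith

/-- `2 + √3 < R(δ₀) = (2+δ₀) + √((2+δ₀)²−1)` for `δ₀ > 0`. [folklore] -/
theorem two_add_sqrt_three_lt_ellR {δ₀ : ℝ} (hδ : 0 < δ₀) :
    2 + Real.sqrt 3 < (2 + δ₀) + Real.sqrt ((2 + δ₀) ^ 2 - 1) := by
  have h3 : Real.sqrt 3 ≤ Real.sqrt ((2 + δ₀) ^ 2 - 1) := by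
    apply Real.sqrt_le_sqrt
    nlinarith
  linarith

/-- The harmonic measure `λ* = log(2+√3)/log R(δ₀)` of the target lies in `(0, 1)`. [folklore] -/
theorem lamStar_mem_Ioo {δ₀ : ℝ} (hδ : 0 < δ₀) :
    0 < Real.log (2 + Real.sqrt 3) / Real.log ((2 + δ₀) + Real.sqrt ((2 + δ₀) ^ 2 - 1)) ∧
      Real.log (2 + Real.sqrt 3) / Real.log ((2 + δ₀) + Real.sqrt ((2 + δ₀) ^ 2 - 1)) < 1 := by
  have h1 : 0 < Real.log (2 + Real.sqrt 3) := Real.log_pos one_lt_two_add_sqrt_three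
  have h2 : Real.log (2 + Real.sqrt 3) < Real.log ((2 + δ₀) + Real.sqrt ((2 + δ₀) ^ 2 - 1)) :=
    Real.log_lt_log (by linarith [one_lt_two_add_sqrt_three]) (two_add_sqrt_three_lt_ellR hδ)
  have h3 : 0 < Real.log ((2 + δ₀) + Real.sqrt ((2 + δ₀) ^ 2 - 1)) := h1.trans h2
  exact ⟨div_pos h1 h3, (div_lt_one h3).mpr h2⟩

/-- The Joukowski preimage `z₀ = −(2+√3)` of the target shift `s = 0`: `‖z₀‖ = 2 + √3`. [folklore] -/
theorem norm_zStar : ‖(-((2 : ℂ) + (Real.sqrt 3 : ℂ)))‖ = 2 + Real.sqrt 3 := by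
  have h : (-((2 : ℂ) + (Real.sqrt 3 : ℂ))) = ((-(2 + Real.sqrt 3) : ℝ) : ℂ) := by
    push_cast; ring
  rw [h, Complex.norm_real, Real.norm_eq_abs, abs_of_neg (by linarith [one_lt_two_add_sqrt_three])]
  ring

/-- `2 + (z₀ + z₀⁻¹)/2 = 0` for `z₀ = −(2+√3)`. [folklore] -/
theorem two_add_jouk_zStar :
    (2 : ℂ) + ((-((2 : ℂ) + (Real.sqrt 3 : ℂ))) + (-((2 : ℂ) + (Real.sqrt 3 : ℂ)))⁻¹) / 2 = 0 := by
  have hs : Real.sqrt 3 ^ 2 = 3 := Real.sq_sqrt (by norm_num)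
  have hinv : (-((2 : ℂ) + (Real.sqrt 3 : ℂ)))⁻¹ = -((2 : ℂ) - (Real.sqrt 3 : ℂ)) := by
    rw [inv_neg, neg_inj, inv_eq_of_mul_eq_one_right]
    have : ((2 : ℂ) + (Real.sqrt 3 : ℂ)) * ((2 : ℂ) - (Real.sqrt 3 : ℂ)) = 4 - (Real.sqrt 3 : ℂ) ^ 2 := by
      ring
    rw [this, ← Complex.ofReal_pow, hs]
    norm_num
  rw [hinv]
  ring

/-! ## §2 The two-constants transfer at the target shift -/

/-- **Two-constants transfer at the target.**  If `h` is holomorphic on the ellipse region `E(δ₀)` of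
complex flavour-blind shifts (foci `1, 3`, left vertex `−δ₀`), bounded by `K` there and by `K e^{−x}` on the
anchor `[1, 3]`, then `‖h 0‖ ≤ K e^{−(1−λ*) x}`, `λ* = log(2+√3)/log R(δ₀)`. [folklore] -/
theorem norm_le_of_ellipse_certificate {δ₀ K x : ℝ} (hδ : 0 < δ₀) (hK : 0 < K) (h : ℂ → ℂ)
    (hd : DifferentiableOn ℂ h ((fun z : ℂ => 2 + (z + z⁻¹) / 2) ''
      {z : ℂ | 1 ≤ ‖z‖ ∧ ‖z‖ < (2 + δ₀) + Real.sqrt ((2 + δ₀) ^ 2 - 1)}))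
    (hB : ∀ s ∈ (fun z : ℂ => 2 + (z + z⁻¹) / 2) ''
      {z : ℂ | 1 ≤ ‖z‖ ∧ ‖z‖ < (2 + δ₀) + Real.sqrt ((2 + δ₀) ^ 2 - 1)}, ‖h s‖ ≤ K)
    (hA : ∀ s : ℝ, s ∈ Set.Icc (1 : ℝ) 3 → ‖h s‖ ≤ K * Real.exp (-x)) :
    ‖h 0‖ ≤ K * Real.exp (-((1 - Real.log (2 + Real.sqrt 3) /
      Real.log ((2 + δ₀) + Real.sqrt ((2 + δ₀) ^ 2 - 1))) * x)) := by
  set R : ℝ := (2 + δ₀) + Real.sqrt ((2 + δ₀) ^ 2 - 1) with hR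
  have hR1 : 1 < R := one_lt_two_add_sqrt_three.trans (two_add_sqrt_three_lt_ellR hδ)
  -- transport `h` to the normalised ellipse with foci `±1`
  set f : ℂ → ℂ := fun w => h (2 + w) with hf
  have hmaps : Set.MapsTo (fun w : ℂ => 2 + w)
      ((fun z : ℂ => (z + z⁻¹) / 2) '' {z : ℂ | 1 ≤ ‖z‖ ∧ ‖z‖ < R})
      ((fun z : ℂ => 2 + (z + z⁻¹) / 2) '' {z : ℂ | 1 ≤ ‖z‖ ∧ ‖z‖ < R}) := by
    rintro w ⟨z, hz, rfl⟩
    exact ⟨z, hz, rfl⟩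
  have hdf : DifferentiableOn ℂ f ((fun z : ℂ => (z + z⁻¹) / 2) '' {z : ℂ | 1 ≤ ‖z‖ ∧ ‖z‖ < R}) :=
    hd.comp ((differentiableOn_const _).add differentiableOn_id) hmaps
  have hBf : ∀ z : ℂ, 1 ≤ ‖z‖ → ‖z‖ < R → ‖f ((z + z⁻¹) / 2)‖ ≤ K :=
    fun z h1 h2 => hB _ ⟨z, ⟨h1, h2⟩, rfl⟩
  have hAf : ∀ t : ℝ, t ∈ Set.Icc (-1 : ℝ) 1 → ‖f t‖ ≤ K * Real.exp (-x) := by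
    intro t ht
    have h23 : (2 : ℂ) + (t : ℂ) = ((2 + t : ℝ) : ℂ) := by push_cast; ring
    simp only [hf, h23]
    exact hA (2 + t) ⟨by linarith [ht.1], by linarith [ht.2]⟩
  have hApos : 0 < K * Real.exp (-x) := mul_pos hK (Real.exp_pos _)
  have hz1 : 1 ≤ ‖(-((2 : ℂ) + (Real.sqrt 3 : ℂ)))‖ := by
    rw [norm_zStar]; exact one_lt_two_add_sqrt_three.le
  have hzR : ‖(-((2 : ℂ) + (Real.sqrt 3 : ℂ)))‖ < R := by
    rw [norm_zStar]; exact two_add_sqrt_three_lt_ellR hδ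
  have key := stub_twoConstants R hR1 (K * Real.exp (-x)) K hApos hK f hdf hBf hAf _ hz1 hzR
  have h0 : f (((-((2 : ℂ) + (Real.sqrt 3 : ℂ))) + (-((2 : ℂ) + (Real.sqrt 3 : ℂ)))⁻¹) / 2) = h 0 := by
    simp only [hf]
    rw [two_add_jouk_zStar]
  rw [h0, norm_zStar] at key
  refine key.trans (le_of_eq ?_)
  set lam : ℝ := Real.log (2 + Real.sqrt 3) / Real.log R with hlam
  rw [Real.mul_rpow hK.le (Real.exp_pos _).le, ← Real.exp_mul, mul_assoc, mul_comm (Real.exp _),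
    ← mul_assoc, ← Real.rpow_add hK, show 1 - lam + lam = 1 by ring, Real.rpow_one]
  congr 1
  congr 1
  ring

/-! ## §3 The Lee–Yang handover on the lattice -/

/-- **Lattice mass gap from the Lee–Yang certificate.**  If at the offset tuple `t` every pair of
gauge-invariant local lattice observables admits a constant `K` and, for all large `k`, all tori
`2S+1 ≥ 2L_k+1` and all separations `n ≤ S`, a function `h` holomorphic on the ellipse region `E(δ₀)` of
complex flavour-blind shifts, bounded by `K` there, bounded by `K e^{−ε a_k n}` on the anchor shifts `[1, 3]`
and with `h 0 =` the connected Euclidean-time correlator at `t`, then the lattice theory of `reg` at `t` has the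
uniform lattice mass gap `ε (1 − λ*)`. [folklore] -/
theorem hasLatticeMassGap_of_leeYangCertificate (reg : QCDRegularisation Nf) (t : Fin Nf → ℝ)
    {ε δ₀ : ℝ} (hδ : 0 < δ₀)
    (hcert : ∀ (R R' : ℕ) (A : QCDLatticeObservable Nf R) (B : QCDLatticeObservable Nf R'),
      ∃ K : ℝ, ∀ᶠ k in atTop, ∀ S : ℕ, reg.L k ≤ S → ∀ n : ℕ, n ≤ S →
        ∃ h : ℂ → ℂ,
          DifferentiableOn ℂ h ((fun z : ℂ => 2 + (z + z⁻¹) / 2) ''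
            {z : ℂ | 1 ≤ ‖z‖ ∧ ‖z‖ < (2 + δ₀) + Real.sqrt ((2 + δ₀) ^ 2 - 1)}) ∧
          (∀ s ∈ (fun z : ℂ => 2 + (z + z⁻¹) / 2) ''
            {z : ℂ | 1 ≤ ‖z‖ ∧ ‖z‖ < (2 + δ₀) + Real.sqrt ((2 + δ₀) ^ 2 - 1)}, ‖h s‖ ≤ K) ∧
          (∀ s : ℝ, s ∈ Set.Icc (1 : ℝ) 3 → ‖h s‖ ≤ K * Real.exp (-(ε * (reg.a k * n)))) ∧
          h 0 = qcdLatticeConnectedCorr (reg.β k) (2 * S + 1)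
            (fun f => (reg.scheme t 0 0).mq f k) A B n) :
    (reg.scheme t 0 0).HasLatticeMassGap
      (ε * (1 - Real.log (2 + Real.sqrt 3) / Real.log ((2 + δ₀) + Real.sqrt ((2 + δ₀) ^ 2 - 1)))) := by
  intro R R' A B
  obtain ⟨K, hK⟩ := hcert R R' A B
  refine ⟨max K 1, ?_⟩
  filter_upwards [hK] with k hk S hS n hn
  obtain ⟨h, hd, hB, hA, h0⟩ := hk S hS n hn
  have hK1 : 0 < max K 1 := lt_max_of_lt_right one_pos
  have hB' : ∀ s ∈ (fun z : ℂ => 2 + (z + z⁻¹) / 2) ''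
      {z : ℂ | 1 ≤ ‖z‖ ∧ ‖z‖ < (2 + δ₀) + Real.sqrt ((2 + δ₀) ^ 2 - 1)}, ‖h s‖ ≤ max K 1 :=
    fun s hs => (hB s hs).trans (le_max_left _ _)
  have hA' : ∀ s : ℝ, s ∈ Set.Icc (1 : ℝ) 3 → ‖h s‖ ≤ max K 1 * Real.exp (-(ε * (reg.a k * n))) :=
    fun s hs => (hA s hs).trans (mul_le_mul_of_nonneg_right (le_max_left _ _) (Real.exp_pos _).le)
  have key := norm_le_of_ellipse_certificate hδ hK1 h hd hB' hA'
  rw [h0] at key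
  simp only [QCDRegularisation.scheme] at key ⊢
  refine key.trans (le_of_eq ?_)
  congr 1
  congr 1
  ring

/-- The rate delivered by the certificate is positive. [folklore] -/
theorem leeYang_rate_pos {ε δ₀ : ℝ} (hε : 0 < ε) (hδ : 0 < δ₀) :
    0 < ε * (1 - Real.log (2 + Real.sqrt 3) / Real.log ((2 + δ₀) + Real.sqrt ((2 + δ₀) ^ 2 - 1))) :=
  mul_pos hε (by linarith [(lamStar_mem_Ioo hδ).2])

/-! ## §4 The form the pin consumes: `OpensBelow` from Lee–Yang openness -/

/-- **`OpensBelow` from Lee–Yang openness.**  If every UNIFORM lattice gap `ε` above an offset `M` comes with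
`δ₀ > 0` such that every tuple of the slab above `M − δ₀` carries the Lee–Yang certificate at rate `ε`, then
every uniformly gapped half-line of offsets of `reg` is open from below — hypothesis (O) of
`PinnedThreshold.robustYangMillsHandover_of_pinInputs`. [folklore] -/
theorem opensBelow_of_leeYangOpenness :
    ∀ reg : QCDRegularisation Nf,
      (∀ (M ε : ℝ), 0 < ε →
        (∀ t : Fin Nf → ℝ, (∀ f, M < t f) → (reg.scheme t 0 0).HasLatticeMassGap ε) →
          ∃ δ₀ : ℝ, 0 < δ₀ ∧ ∀ t : Fin Nf → ℝ, (∀ f, M - δ₀ < t f) →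
            ∀ (R R' : ℕ) (A : QCDLatticeObservable Nf R) (B : QCDLatticeObservable Nf R'),
              ∃ K : ℝ, ∀ᶠ k in atTop, ∀ S : ℕ, reg.L k ≤ S → ∀ n : ℕ, n ≤ S →
                ∃ h : ℂ → ℂ,
                  DifferentiableOn ℂ h ((fun z : ℂ => 2 + (z + z⁻¹) / 2) ''
                    {z : ℂ | 1 ≤ ‖z‖ ∧ ‖z‖ < (2 + δ₀) + Real.sqrt ((2 + δ₀) ^ 2 - 1)}) ∧
                  (∀ s ∈ (fun z : ℂ => 2 + (z + z⁻¹) / 2) ''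
                    {z : ℂ | 1 ≤ ‖z‖ ∧ ‖z‖ < (2 + δ₀) + Real.sqrt ((2 + δ₀) ^ 2 - 1)}, ‖h s‖ ≤ K) ∧
                  (∀ s : ℝ, s ∈ Set.Icc (1 : ℝ) 3 → ‖h s‖ ≤ K * Real.exp (-(ε * (reg.a k * n)))) ∧
                  h 0 = qcdLatticeConnectedCorr (reg.β k) (2 * S + 1)
                    (fun f => (reg.scheme t 0 0).mq f k) A B n) →
      ∀ M : ℝ,
        (∃ ε > (0 : ℝ), ∀ t : Fin Nf → ℝ, (∀ f, M < t f) → (reg.scheme t 0 0).HasLatticeMassGap ε) →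
          ∃ δ > (0 : ℝ), ∀ t : Fin Nf → ℝ, (∀ f, M - δ < t f) →
            ∃ Δ > (0 : ℝ), (reg.scheme t 0 0).HasLatticeMassGap Δ := by
  intro reg hLY M hM
  obtain ⟨ε, hε, hgap⟩ := hM
  obtain ⟨δ₀, hδ₀, hslab⟩ := hLY M ε hε hgap
  exact ⟨δ₀, hδ₀, fun t ht => ⟨_, leeYang_rate_pos hε hδ₀,
    hasLatticeMassGap_of_leeYangCertificate reg t hδ₀ (hslab t ht)⟩⟩

end Summit.QuantumFields.QCD.Theorems.RobustYangMillsHandover.LeeYangCertificate
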